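import Mathlib.Analysis.Calculus.Deriv.Pow
import Mathlib.Analysis.Calculus.Deriv.Mul
import Mathlib.Analysis.Calculus.Deriv.Add
import Mathlib.Algebra.BigOperators.Ring.Finset
import Mathlib.Data.Real.Basic
import HarnessLib

/-!
# Lattice φ⁴: the site force `∂S/∂φ_x`, the Euler identity `Σ_x φ_x ∂S/∂φ_x = 2S₂ + 4S₄`, and the single-site restriction (the bookkeeping under the φ⁴ Schwinger–Dyson column)

HONEST FRAMING: exact (Metropolis-corrected) sampling algorithms for lattice gauge theory;
figures of merit are autocorrelation/cost numbers at stated couplings and volumes; no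
continuum-physics claim.  (SCALAR calibration rung S0-A: not a gauge result.)

Venture `LatticeQCDFlow` (cell pub-lqcd), sub-topic `Scoring`; FANOUT row 2 (`s0-phi4`).  NEW WORK
of the cell (finite sums and one-variable calculus; our own statements and proofs), companion of
`Scoring/SchwingerDysonPhi4.lean` (the one-variable Schwinger–Dyson tower `⟨φⁿV'(φ)⟩ = n⟨φⁿ⁻¹⟩`
for the quartic SITE law `∝ e^{−(λφ⁴ + aφ² + bφ + c)}`).  This file supplies, with NO measure
theory, the algebra that connects that site law to a lattice φ⁴ action and fixes the constants
`a, b` an implementation of the residual `R_x = φ_x ∂S/∂φ_x − 1` must use: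

* `latticePhi4Action J λ φ = Σ_{x,y} φ_x J_{xy} φ_y + λ Σ_x φ_x⁴` on ANY finite site set with ANY
  real matrix `J` (no symmetry, dimension or boundary condition assumed) and its site force
  `latticePhi4Force J λ φ x = Σ_y (J_{xy} + J_{yx}) φ_y + 4λ φ_x³`;
* **`hasDerivAt_latticePhi4Action_update`** — `F_x(φ)` IS `∂S/∂φ_x`: the derivative of
  `t ↦ S(φ with φ_x := t)` at `t = φ_x`;
* **`sum_mul_latticePhi4Force`** — Euler: `Σ_x φ_x F_x(φ) = 2 S₂(φ) + 4 S₄(φ)`; so the per-site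
  virial identities `⟨φ_x F_x⟩ = 1` sum to `2⟨S₂⟩ + 4⟨S₄⟩ = |Λ|`, the interacting replacement of
  the free-field equipartition line `⟨S⟩/V = 1/2` of the exactness battery (leg T1);
* **`latticePhi4Action_update`** — the single-site restriction: with the other sites frozen,
  `S(φ with φ_x := t) = λt⁴ + J_{xx}t² + b_x t + C`, `b_x = Σ_y (J_{xy}+J_{yx}) ψ_y`,
  `ψ = (φ with φ_x := 0)`, `C = S(ψ)` — literally `phi4SitePotential λ J_{xx} b_x C t` of the
  companion file, whose theorems (`λ > 0`, any `a b c`) therefore give `⟨φ_x F_x(φ) | φ_{≠x}⟩ = 1`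
  for the conditional law; `latticePhi4Force_eq` — the site-law force at `t = φ_x` is `F_x(φ)`;
* the ENGINE'S CONVENTION as an instance (`shiftPhi4Action`, latflow.core `phi4_2d`, AKS 2019 /
  Kanwar thesis eq. (3.35): `S = Σ_x [Σ_μ (φ(x+μ) − φ(x))² + m² φ_x² + λ φ_x⁴]`, directions acting by
  bijections `σ_μ` of the site set): **`shiftPhi4Action_eq`** (`J = shiftCoupling σ m²`, i.e.
  `−Δ_lat + m²`), `latticePhi4Force_shift`
  (`∂S/∂φ_x = Σ_μ (4φ_x − 2φ(x+μ) − 2φ(x−μ)) + 2m²φ_x + 4λφ_x³` = `phi4_2d.force`), and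
  **`shiftCoupling_diag`**: the conditional quadratic coefficient is `a = J_{xx} = 2d + m²`
  whenever no direction fixes the site (`L_μ ≥ 2`) — on every AKS 2019 set (`d = 2`, `m² = −4`)
  `a = 0`, so the conditional law is confined by the quartic term alone (the reason the companion
  file asks only `λ > 0`).

What is NOT here: the integration over `ℝ^Λ` (Fubini + the conditional-law statement as
measures) that turns the two files into `⟨φ_x F_x⟩_S = 1` for the full lattice Gibbs measure, and
anything about the statistical power of the column.
-/

namespace Summit.Ventures.LatticeQCDFlow.Scoring

open Finset

variable {Λ : Type*} [Fintype Λ] [DecidableEq Λ]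

/-- A lattice φ⁴ action in coupling-matrix form: `S(φ) = Σ_{x,y} φ_x J_{xy} φ_y + λ Σ_x φ_x⁴`
(any finite site set, any real matrix `J`, no symmetry assumed). -/
noncomputable def latticePhi4Action (J : Λ → Λ → ℝ) (lam : ℝ) (φ : Λ → ℝ) : ℝ :=
  (∑ x, ∑ y, φ x * J x y * φ y) + lam * ∑ x, φ x ^ 4

/-- The site force `F_x(φ) = Σ_y (J_{xy} + J_{yx}) φ_y + 4λ φ_x³` — by
`hasDerivAt_latticePhi4Action_update` it is `∂S/∂φ_x`. -/
noncomputable def latticePhi4Force (J : Λ → Λ → ℝ) (lam : ℝ) (φ : Λ → ℝ) (x : Λ) : ℝ :=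
  (∑ y, (J x y + J y x) * φ y) + 4 * lam * φ x ^ 3

omit [DecidableEq Λ] in
/-- **Euler identity.** `Σ_x φ_x F_x(φ) = 2 S₂(φ) + 4 S₄(φ)` with `S₂ = Σ φJφ` the quadratic and
`S₄ = λ Σ φ⁴` the quartic part of the action. -/
theorem sum_mul_latticePhi4Force (J : Λ → Λ → ℝ) (lam : ℝ) (φ : Λ → ℝ) :
    ∑ x, φ x * latticePhi4Force J lam φ x
      = 2 * (∑ x, ∑ y, φ x * J x y * φ y) + 4 * (lam * ∑ x, φ x ^ 4) := by
  have hsplit : ∀ x, φ x * latticePhi4Force J lam φ x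
      = (∑ y, φ x * J x y * φ y) + (∑ y, φ y * J y x * φ x) + 4 * (lam * φ x ^ 4) := by
    intro x
    unfold latticePhi4Force
    rw [mul_add, Finset.mul_sum, ← Finset.sum_add_distrib]
    congr 1
    · exact Finset.sum_congr rfl fun y _ => by ring
    · ring
  simp only [hsplit, Finset.sum_add_distrib]
  rw [Finset.sum_comm (f := fun x y => φ y * J y x * φ x), ← Finset.mul_sum, ← Finset.mul_sum]
  ring

omit [Fintype Λ] in
/-- The coordinate map `s ↦ (φ with φ_x := s)_y` has derivative `[y = x]`. -/
theorem hasDerivAt_update_apply (φ : Λ → ℝ) (x y : Λ) (t : ℝ) :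
    HasDerivAt (fun s : ℝ => Function.update φ x s y) (if y = x then 1 else 0) t := by
  by_cases h : y = x
  · subst h
    simp only [Function.update_self, if_true]
    exact hasDerivAt_id t
  · simp only [Function.update_of_ne h, if_neg h]
    exact hasDerivAt_const t (φ y)

/-- **`F_x = ∂S/∂φ_x`**: the derivative of `t ↦ S(φ with φ_x := t)` at `t = φ_x` is `F_x(φ)`. -/
theorem hasDerivAt_latticePhi4Action_update (J : Λ → Λ → ℝ) (lam : ℝ) (φ : Λ → ℝ) (x : Λ) :
    HasDerivAt (fun t : ℝ => latticePhi4Action J lam (Function.update φ x t))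
      (latticePhi4Force J lam φ x) (φ x) := by
  have hu := fun y => hasDerivAt_update_apply φ x y (φ x)
  have hq : ∀ y z, HasDerivAt
      (fun t : ℝ => Function.update φ x t y * J y z * Function.update φ x t z)
      ((if y = x then (1 : ℝ) else 0) * J y z * φ z
        + φ y * J y z * (if z = x then (1 : ℝ) else 0)) (φ x) := by
    intro y z
    have h := ((hu y).mul_const (J y z)).mul (hu z)
    simp only [Function.update_eq_self] at h
    exact h
  have hquad : HasDerivAt
      (fun t : ℝ => ∑ y, ∑ z, Function.update φ x t y * J y z * Function.update φ x t z)
      (∑ y, ∑ z, ((if y = x then (1 : ℝ) else 0) * J y z * φ z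
        + φ y * J y z * (if z = x then (1 : ℝ) else 0))) (φ x) :=
    HasDerivAt.fun_sum (u := Finset.univ) fun y _ =>
      HasDerivAt.fun_sum (u := Finset.univ) fun z _ => hq y z
  have hp : ∀ y, HasDerivAt (fun t : ℝ => Function.update φ x t y ^ 4)
      (((4 : ℕ) : ℝ) * φ y ^ (4 - 1) * (if y = x then (1 : ℝ) else 0)) (φ x) := by
    intro y
    have h := (hu y).fun_pow 4
    simp only [Function.update_eq_self] at h
    exact h
  have hquart : HasDerivAt (fun t : ℝ => lam * ∑ y, Function.update φ x t y ^ 4)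
      (lam * ∑ y, ((4 : ℕ) : ℝ) * φ y ^ (4 - 1) * (if y = x then (1 : ℝ) else 0)) (φ x) :=
    (HasDerivAt.fun_sum (u := Finset.univ) fun y _ => hp y).const_mul lam
  have h := hquad.fun_add hquart
  unfold latticePhi4Action
  refine h.congr_deriv ?_
  -- evaluate the Kronecker sums
  have hA : ∑ y, ∑ z, (if y = x then (1 : ℝ) else 0) * J y z * φ z = ∑ z, J x z * φ z := by
    simp only [ite_mul, zero_mul, one_mul, Finset.sum_ite_irrel, Finset.sum_const_zero,
      Finset.sum_ite_eq', Finset.mem_univ, if_true]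
  have hB : ∑ y, ∑ z, φ y * J y z * (if z = x then (1 : ℝ) else 0) = ∑ y, φ y * J y x := by
    simp only [mul_boole, Finset.sum_ite_eq', Finset.mem_univ, if_true]
  have hC : ∑ y, ((4 : ℕ) : ℝ) * φ y ^ (4 - 1) * (if y = x then (1 : ℝ) else 0)
      = 4 * φ x ^ 3 := by
    simp only [mul_boole, Finset.sum_ite_eq', Finset.mem_univ, if_true]
    norm_num
  rw [Finset.sum_congr rfl fun y _ => Finset.sum_add_distrib, Finset.sum_add_distrib, hA, hB, hC]
  unfold latticePhi4Force
  rw [Finset.sum_congr rfl fun y _ => add_mul (J x y) (J y x) (φ y), Finset.sum_add_distrib]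
  have hBx : ∑ y, φ y * J y x = ∑ y, J y x * φ y := Finset.sum_congr rfl fun y _ => by ring
  rw [hBx]
  ring

omit [Fintype Λ] in
/-- Pointwise decomposition of an updated configuration: `(φ with φ_x := t) = ψ + t·δ_x` with
`ψ = (φ with φ_x := 0)`. -/
theorem update_apply_eq_add_ite (φ : Λ → ℝ) (x : Λ) (t : ℝ) (y : Λ) :
    Function.update φ x t y = Function.update φ x 0 y + t * (if y = x then 1 else 0) := by
  by_cases h : y = x
  · subst h
    simp only [Function.update_self, if_true, mul_one, zero_add]
  · simp only [Function.update_of_ne h, if_neg h, mul_zero, add_zero]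

/-- **Single-site restriction.**  With every other site frozen, `t ↦ S(φ with φ_x := t)` is the
quartic site potential `λ t⁴ + J_{xx} t² + b_x t + C` with `b_x = Σ_y (J_{xy} + J_{yx}) ψ_y`,
`ψ = (φ with φ_x := 0)` (so the `y = x` term drops) and `C = S(ψ)` — i.e.
`phi4SitePotential λ J_{xx} b_x C t` of `Scoring/SchwingerDysonPhi4.lean`: the conditional law of
`φ_x` under `e^{−S}` is the single-site law of that file with `a = J_{xx}`. -/
theorem latticePhi4Action_update (J : Λ → Λ → ℝ) (lam : ℝ) (φ : Λ → ℝ) (x : Λ) (t : ℝ) :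
    latticePhi4Action J lam (Function.update φ x t)
      = lam * t ^ 4 + J x x * t ^ 2
        + (∑ y, (J x y + J y x) * Function.update φ x 0 y) * t
        + latticePhi4Action J lam (Function.update φ x 0) := by
  set ψ := Function.update φ x 0 with hψ
  have hψx : ψ x = 0 := by simp [hψ]
  have hu : ∀ y, Function.update φ x t y = ψ y + t * (if y = x then 1 else 0) :=
    update_apply_eq_add_ite φ x t
  -- quadratic part
  have hquad : ∑ y, ∑ z, Function.update φ x t y * J y z * Function.update φ x t z
      = (∑ y, ∑ z, ψ y * J y z * ψ z) + t * (∑ z, J x z * ψ z) + t * (∑ y, ψ y * J y x)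
        + t ^ 2 * J x x := by
    have hexp : ∀ y z, Function.update φ x t y * J y z * Function.update φ x t z
        = ψ y * J y z * ψ z + (if y = x then (1 : ℝ) else 0) * (t * (J y z * ψ z))
          + t * (ψ y * J y z) * (if z = x then (1 : ℝ) else 0)
          + (if y = x then (1 : ℝ) else 0) * (t ^ 2 * J y z * (if z = x then (1 : ℝ) else 0)) := by
      intro y z
      rw [hu y, hu z]
      ring
    simp only [hexp, Finset.sum_add_distrib, boole_mul, mul_boole, Finset.sum_ite_irrel,
      Finset.sum_const_zero, Finset.sum_ite_eq', Finset.mem_univ, if_true, ← Finset.mul_sum]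
  -- quartic part
  have hp4 : ∀ y, Function.update φ x t y ^ 4 = ψ y ^ 4 + (if y = x then t ^ 4 else 0) := by
    intro y
    by_cases h : y = x
    · subst h
      simp only [Function.update_self, if_true, hψx]
      ring
    · simp only [Function.update_of_ne h, if_neg h, add_zero, hψ]
  have hquart : ∑ y, Function.update φ x t y ^ 4 = (∑ y, ψ y ^ 4) + t ^ 4 := by
    simp only [hp4, Finset.sum_add_distrib, Finset.sum_ite_eq', Finset.mem_univ, if_true]
  unfold latticePhi4Action
  rw [hquad, hquart]
  have hb : ∑ y, (J x y + J y x) * ψ y = (∑ z, J x z * ψ z) + ∑ y, ψ y * J y x := by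
    rw [← Finset.sum_add_distrib]
    exact Finset.sum_congr rfl fun y _ => by ring
  rw [hb]
  ring

omit [Fintype Λ] in
/-- `φ` itself is `ψ + φ_x·δ_x`. -/
theorem apply_eq_update_zero_add_ite (φ : Λ → ℝ) (x y : Λ) :
    φ y = Function.update φ x 0 y + φ x * (if y = x then 1 else 0) := by
  have h := update_apply_eq_add_ite φ x (φ x) y
  rwa [Function.update_eq_self] at h

/-- **Consistency of the two force formulas.**  The derivative of the restricted site potential
at `t = φ_x`, `4λ φ_x³ + 2 J_{xx} φ_x + b_x`, is the lattice site force `F_x(φ)` (this is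
`phi4SiteForce λ J_{xx} b_x (φ_x)` of `Scoring/SchwingerDysonPhi4.lean`). -/
theorem latticePhi4Force_eq (J : Λ → Λ → ℝ) (lam : ℝ) (φ : Λ → ℝ) (x : Λ) :
    4 * lam * φ x ^ 3 + 2 * J x x * φ x
        + ∑ y, (J x y + J y x) * Function.update φ x 0 y
      = latticePhi4Force J lam φ x := by
  unfold latticePhi4Force
  have h : ∀ y, (J x y + J y x) * φ y
      = (J x y + J y x) * Function.update φ x 0 y
        + φ x * (J x y + J y x) * (if y = x then (1 : ℝ) else 0) := by
    intro y
    rw [apply_eq_update_zero_add_ite φ x y]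
    ring
  simp only [h, Finset.sum_add_distrib, mul_boole, Finset.sum_ite_eq', Finset.mem_univ, if_true]
  ring

/-! ## The engine's nearest-neighbour action as an instance -/

section Shift

variable {ι : Type*} [Fintype ι]

/-- The nearest-neighbour φ⁴ action in the engine's convention (latflow.core `phi4_2d`; AKS 2019,
Kanwar thesis eq. (3.35); NO 1/2, NO 1/4): `S(φ) = Σ_x [Σ_μ (φ(σ_μ x) − φ(x))² + m² φ_x² + λ φ_x⁴]`,
the directions `μ : ι` acting on the finite site set by bijections `σ_μ` (on the periodic
`L₀ × L₁` lattice `σ_μ x = x + e_μ`; any dimension, any such boundary condition). -/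
noncomputable def shiftPhi4Action (σ : ι → Equiv.Perm Λ) (m2 lam : ℝ) (φ : Λ → ℝ) : ℝ :=
  ∑ x, ((∑ μ, (φ (σ μ x) - φ x) ^ 2) + m2 * φ x ^ 2 + lam * φ x ^ 4)

/-- Its coupling matrix `J = −Δ_lat + m²·1` in Kronecker form:
`J_{xy} = Σ_μ (2[y = x] − 2[y = σ_μ x]) + m² [y = x]`. -/
noncomputable def shiftCoupling (σ : ι → Equiv.Perm Λ) (m2 : ℝ) (x y : Λ) : ℝ :=
  (∑ μ, ((if y = x then (2 : ℝ) else 0) - (if y = σ μ x then (2 : ℝ) else 0)))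
    + m2 * (if y = x then (1 : ℝ) else 0)

/-- Row action of `J`: `Σ_y J_{xy} φ_y = Σ_μ (2φ_x − 2φ(σ_μ x)) + m² φ_x`. -/
theorem sum_shiftCoupling_mul (σ : ι → Equiv.Perm Λ) (m2 : ℝ) (φ : Λ → ℝ) (x : Λ) :
    ∑ y, shiftCoupling σ m2 x y * φ y = (∑ μ, (2 * φ x - 2 * φ (σ μ x))) + m2 * φ x := by
  have h : ∀ y, shiftCoupling σ m2 x y * φ y
      = (∑ μ, ((if y = x then 2 * φ y else 0) - (if y = σ μ x then 2 * φ y else 0)))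
        + m2 * (if y = x then φ y else 0) := by
    intro y
    unfold shiftCoupling
    rw [add_mul, Finset.sum_mul, mul_assoc, Finset.sum_congr rfl fun μ _ => sub_mul _ _ (φ y)]
    simp only [ite_mul, zero_mul, one_mul]
  simp only [h]
  rw [Finset.sum_add_distrib, Finset.sum_comm, ← Finset.mul_sum]
  simp only [Finset.sum_sub_distrib, Finset.sum_ite_eq', Finset.mem_univ, if_true]

/-- Column action of `J`: `Σ_y J_{yx} φ_y = Σ_μ (2φ_x − 2φ(σ_μ⁻¹ x)) + m² φ_x` (the sum over `y`
is re-indexed through the bijection `σ_μ`). -/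
theorem sum_shiftCoupling_transpose_mul (σ : ι → Equiv.Perm Λ) (m2 : ℝ) (φ : Λ → ℝ) (x : Λ) :
    ∑ y, shiftCoupling σ m2 y x * φ y
      = (∑ μ, (2 * φ x - 2 * φ ((σ μ).symm x))) + m2 * φ x := by
  have h : ∀ y, shiftCoupling σ m2 y x * φ y
      = (∑ μ, ((if x = y then 2 * φ y else 0) - (if x = σ μ y then 2 * φ y else 0)))
        + m2 * (if x = y then φ y else 0) := by
    intro y
    unfold shiftCoupling
    rw [add_mul, Finset.sum_mul, mul_assoc, Finset.sum_congr rfl fun μ _ => sub_mul _ _ (φ y)]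
    simp only [ite_mul, zero_mul, one_mul]
  have hcol : ∀ μ, ∑ y, (if x = σ μ y then 2 * φ y else 0) = 2 * φ ((σ μ).symm x) := by
    intro μ
    have e := Equiv.sum_comp (σ μ) (fun w => if x = w then 2 * φ ((σ μ).symm w) else 0)
    simp only [Equiv.symm_apply_apply] at e
    rw [e, Finset.sum_ite_eq, if_pos (Finset.mem_univ _)]
  simp only [h]
  rw [Finset.sum_add_distrib, Finset.sum_comm, ← Finset.mul_sum]
  simp only [Finset.sum_sub_distrib, hcol, Finset.sum_ite_eq, Finset.mem_univ, if_true]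

/-- **The engine's action is a coupling-matrix action** with `J = shiftCoupling σ m²`. -/
theorem shiftPhi4Action_eq (σ : ι → Equiv.Perm Λ) (m2 lam : ℝ) (φ : Λ → ℝ) :
    shiftPhi4Action σ m2 lam φ = latticePhi4Action (shiftCoupling σ m2) lam φ := by
  have hR : ∀ x, ∑ y, φ x * shiftCoupling σ m2 x y * φ y
      = (∑ μ, φ x * (2 * φ x - 2 * φ (σ μ x))) + m2 * φ x ^ 2 := by
    intro x
    have e : ∑ y, φ x * shiftCoupling σ m2 x y * φ y = φ x * ∑ y, shiftCoupling σ m2 x y * φ y := by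
      rw [Finset.mul_sum]
      exact Finset.sum_congr rfl fun y _ => by ring
    rw [e, sum_shiftCoupling_mul, mul_add, Finset.mul_sum]
    ring
  have hK : ∀ μ, ∑ x, (φ (σ μ x) - φ x) ^ 2 = ∑ x, φ x * (2 * φ x - 2 * φ (σ μ x)) := by
    intro μ
    have hperm : ∑ x, φ (σ μ x) ^ 2 = ∑ x, φ x ^ 2 := Equiv.sum_comp (σ μ) (fun x => φ x ^ 2)
    have e1 : ∑ x, (φ (σ μ x) - φ x) ^ 2
        = ∑ x, φ (σ μ x) ^ 2 + ∑ x, (φ x ^ 2 - 2 * φ (σ μ x) * φ x) := by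
      rw [← Finset.sum_add_distrib]
      exact Finset.sum_congr rfl fun x _ => by ring
    rw [e1, hperm, ← Finset.sum_add_distrib]
    exact Finset.sum_congr rfl fun x _ => by ring
  have eL : shiftPhi4Action σ m2 lam φ
      = (∑ μ, ∑ x, (φ (σ μ x) - φ x) ^ 2) + ∑ x, (m2 * φ x ^ 2 + lam * φ x ^ 4) := by
    unfold shiftPhi4Action
    rw [Finset.sum_comm, ← Finset.sum_add_distrib]
    exact Finset.sum_congr rfl fun x _ => by ring
  have eR : latticePhi4Action (shiftCoupling σ m2) lam φ
      = (∑ μ, ∑ x, φ x * (2 * φ x - 2 * φ (σ μ x))) + ∑ x, (m2 * φ x ^ 2 + lam * φ x ^ 4) := by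
    unfold latticePhi4Action
    simp only [hR, Finset.sum_add_distrib, Finset.mul_sum]
    rw [Finset.sum_comm]
    ring
  rw [eL, eR, Finset.sum_congr rfl fun μ _ => hK μ]

/-- **The engine's site force**: `∂S/∂φ_x = Σ_μ (4φ_x − 2φ(x+μ) − 2φ(x−μ)) + 2m² φ_x + 4λ φ_x³`
(`phi4_2d.force`), i.e. `latticePhi4Force` of the coupling matrix. -/
theorem latticePhi4Force_shift (σ : ι → Equiv.Perm Λ) (m2 lam : ℝ) (φ : Λ → ℝ) (x : Λ) :
    latticePhi4Force (shiftCoupling σ m2) lam φ x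
      = (∑ μ, (4 * φ x - 2 * φ (σ μ x) - 2 * φ ((σ μ).symm x))) + 2 * m2 * φ x
        + 4 * lam * φ x ^ 3 := by
  unfold latticePhi4Force
  rw [Finset.sum_congr rfl fun y _ => add_mul _ _ (φ y), Finset.sum_add_distrib,
    sum_shiftCoupling_mul, sum_shiftCoupling_transpose_mul]
  have e : ∑ μ, (4 * φ x - 2 * φ (σ μ x) - 2 * φ ((σ μ).symm x))
      = ∑ μ, (2 * φ x - 2 * φ (σ μ x)) + ∑ μ, (2 * φ x - 2 * φ ((σ μ).symm x)) := by
    rw [← Finset.sum_add_distrib]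
    exact Finset.sum_congr rfl fun μ _ => by ring
  rw [e]
  ring

omit [Fintype Λ] in
/-- **The conditional quadratic coefficient** `a = J_{xx} = 2d + m²` when no direction fixes the
site (`σ_μ x ≠ x`, i.e. every extent `L_μ ≥ 2`): on the AKS 2019 sets (`d = 2`, `m² = −4`) it
VANISHES. -/
theorem shiftCoupling_diag (σ : ι → Equiv.Perm Λ) (m2 : ℝ) (x : Λ) (hσ : ∀ μ, σ μ x ≠ x) :
    shiftCoupling σ m2 x x = 2 * Fintype.card ι + m2 := by
  unfold shiftCoupling
  have h : ∀ μ ∈ (Finset.univ : Finset ι),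
      ((if x = x then (2 : ℝ) else 0) - (if x = σ μ x then (2 : ℝ) else 0)) = 2 := by
    intro μ _
    rw [if_pos rfl, if_neg (fun h => hσ μ h.symm)]
    ring
  rw [Finset.sum_congr rfl h, Finset.sum_const, Finset.card_univ, if_pos rfl, nsmul_eq_mul]
  ring

end Shift

end Summit.Ventures.LatticeQCDFlow.Scoring
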